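import Summits.BirchSwinnertonDyer.BirchSwinnertonDyer.Theorems.SignedLowerHalvesSmallImageLowerHalfBothSignsLambdaLowerThreeNsThetaPartnerAssembly
import Summits.BirchSwinnertonDyer.BirchSwinnertonDyer.Theorems.SignedLowerHalvesSmallImageLowerHalfBothSignsLambdaLowerThreeNsThetaPartnerSansLevelOfR6
import HarnessLib

/-!
# K0₂@p WITHOUT ITS LEVEL CLAUSE, class-wide and hypothesis-free: the odd-`p` Hecke theta partner of every
# small-image X7 pair (R6 `heckeThetaPartner_of_inertField` ∘ `heckeThetaPartner_sansLevel_of_R6`)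

Route `SignedLowerHalves`, child L `SmallImageLowerHalfBothSigns` (item stmt-BirchSwinnertonDyer-23599), line `rtt_w3`
(skeleton of record 93f5c6538fc2784e; v2 proposal `Lines/rtt_w3_v2.lean`), stub K0₂@p `stub_heckeThetaPartner_ns`
(width seat `bsd-line-slh-p3-w3` gen 10; memos `Lines/birth_acns-MEMO-w3-g9.md`, `…-w3-g10.md`).  THEOREMS ONLY (no
definition, no named fact, no `sorry`); ROUTE-INDEPENDENT (no `Theses` import).

* `heckeThetaPartner_sansLevel` — for `E = W/ℚ` globally minimal, `p ≠ 2`, `ClassX7 W p` and `ρ̄_{E,p}` NOT onto: there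
  is a CM newform `g` of weight `2` on some `Γ₀(M)` with `p ∤ M`, every prime factor of `M` bad for `E`, `a_p(g) = 0`, a
  cohomological plus period along some `ι_g : K_g → ℚ̄_p`, and `a_ℓ(g) ≡ a_ℓ(E)` `p`-adically at every prime
  `ℓ ∤ p·M·N_E` — gen 9's assembly theorem R6 `heckeThetaPartner_of_inertField` (ORIENT-CFT, MATCHING, TWIST, NEBENTYPUS,
  TRACE, SOCKET: Hecke–Shimura–Ribet) with ALL its hypotheses discharged by `heckeThetaPartner_sansLevel_of_R6`
  (`…ThetaPartnerSansLevelOfR6`: frame + small-image datum + AH1a–c).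
* `heckeThetaPartner_sansLevel_classwide` — the same in the binder shape of the v2 stub `stub_heckeThetaPartner_ns` of
  `Lines/rtt_w3_v2.lean` VERBATIM (`¬CM`, `a_p = 0` idle): once v2 is registered the stub is this theorem BY NAME.

What is NOT here: the level clause `max 2 (v_ℓ M) = max 2 (v_ℓ N_E)` (v2's `stub_levelMatch_ns`: Deligne + Carayol + Saito by
name); Kan₂ / Kλ₂; the `μ`-rider at `p ≥ 5`.  BSD, crux L and the main conjecture are NOT proved here.

References: J.-P. Serre, Invent. Math. 15 (1972) §2, §4.2, §5.2 (iv); K. Ribet, LNM 601 (1977) §3; E. Hecke 1926;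
G. Shimura 1971–73; J. Neukirch, ANT I §8–§9, IV §1, VI–VII.
-/

set_option autoImplicit false
set_option linter.dupNamespace false

noncomputable section

open scoped Classical NumberField MatrixGroups
open IsDedekindDomain Field NumberField WeierstrassCurve CongruenceSubgroup
  Literature.NumberTheory.EllipticCurves Literature.NumberTheory.GaloisRepresentations
  Literature.NumberTheory.EllipticCurves.Rank1Residual Summit.BirchSwinnertonDyer.Rank1Residual
  Literature.NumberTheory.EllipticCurves.ModularForms Literature.NumberTheory.Automorphic

namespace Summit.BirchSwinnertonDyer.BirchSwinnertonDyer.Theorems.SmallImageLambdaLowerThreeNsThetaPartner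

/-- **K0₂@p without its level clause** — the odd-`p` Hecke theta partner of a small-image X7 pair, hypothesis-free
(R6 `heckeThetaPartner_of_inertField` applied through `heckeThetaPartner_sansLevel_of_R6`). See the module docstring.
[cite: Serre1972, §2.2 Prop. 14, §4.2 c), §5.2 (iv)] [cite: Ribet1977Nebentypus, §3 Thm. 3.6]
[cite: NeukirchANT1999, Ch. VII §6 (6.14)] -/
theorem heckeThetaPartner_sansLevel (W : WeierstrassCurve ℚ) [W.IsElliptic] [W.IsGloballyMinimal] (p : ℕ)
    [Fact p.Prime] (hp2 : p ≠ 2) (hX : ClassX7 W p) (hs : ¬ Surj W p) :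
    ∃ (M : ℕ) (_ : NeZero M) (g : CuspForm (Gamma0 M) 2)
      (ιg : coeffField g →+* PadicAlgCl p) (Ω : ℂ),
      ¬ p ∣ M ∧ (∀ (ℓ : ℕ) [Fact ℓ.Prime], ℓ ∣ M → ¬ W.HasGoodReductionAtPrime ℓ) ∧ IsNewform0 g ∧
        IsCMForm (liftToGamma1 M 2 g) ∧ cuspCoeff g p = 0 ∧ IsCohomologicalPlusPeriod g ιg Ω ∧
        ∀ ℓ : ℕ, ℓ.Prime → ¬ ℓ ∣ p * M * W.conductorNorm ℤ →
          ‖embCoeff g ιg ℓ - (W.frobeniusTrace ℓ : PadicAlgCl p)‖ < 1 :=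
  heckeThetaPartner_sansLevel_of_R6 @heckeThetaPartner_of_inertField W p hp2 hX hs

/-- **K0₂@p without its level clause, class-wide** — VERBATIM the v2 stub `stub_heckeThetaPartner_ns` of
`Lines/rtt_w3_v2.lean` (= the conclusion shape of `heckeThetaPartner_classwide_of_arithmeticHalf`; the hypotheses
`¬ W.HasCM` and `a_p = 0` are idle).  Unconditional: no named fact, no stub.
[cite: Serre1972, §4.2 c), §5.2 (iv)] [cite: Ribet1977Nebentypus, §3 Thm. 3.6] -/
theorem heckeThetaPartner_sansLevel_classwide :
    ∀ (W : WeierstrassCurve ℚ) [W.IsElliptic] [W.IsGloballyMinimal] (p : ℕ) [Fact p.Prime],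
      p ≠ 2 → ClassX7 W p → ¬ W.HasCM → W.frobeniusTrace p = 0 → ¬ Surj W p →
      ∃ (M : ℕ) (_ : NeZero M) (g : CuspForm (Gamma0 M) 2)
        (ι : coeffField g →+* PadicAlgCl p) (Ω : ℂ),
        ¬ p ∣ M ∧ IsNewform0 g ∧ Literature.NumberTheory.Automorphic.IsCMForm (liftToGamma1 M 2 g) ∧
          cuspCoeff g p = 0 ∧ IsCohomologicalPlusPeriod g ι Ω ∧
          (∀ ℓ : ℕ, ℓ.Prime → ¬ ℓ ∣ p * M * W.conductorNorm ℤ →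
            ‖embCoeff g ι ℓ - (W.frobeniusTrace ℓ : PadicAlgCl p)‖ < 1) := by
  intro W _ _ p _ hp hX _ _ hs
  obtain ⟨M, hM, g, ι, Ω, hpM, -, hnew, hcm, hap, hΩ, hcong⟩ := heckeThetaPartner_sansLevel W p hp hX hs
  exact ⟨M, hM, g, ι, Ω, hpM, hnew, hcm, hap, hΩ, hcong⟩


/-- **The REGISTERED stub `stub_heckeThetaPartner_ns` of `Lines/rtt_w3.lean` (v2, skeleton of record of item
stmt-BirchSwinnertonDyer-23599 since 2026-08-29T19:01:30Z), TYPE VERBATIM, proved** — by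
`heckeThetaPartner_sansLevel_classwide`.  Unconditional: no named fact, no stub, no `sorry`.
[cite: Serre1972, §4.2 c), §5.2 (iv)] [cite: Ribet1977Nebentypus, §3 Thm. 3.6] -/
theorem stub_heckeThetaPartner_ns : ∀ (W : WeierstrassCurve ℚ) [W.IsElliptic] [W.IsGloballyMinimal] (p : ℕ) [Fact p.Prime],
      p ≠ 2 → ClassX7 W p → ¬ W.HasCM → W.frobeniusTrace p = 0 → ¬ Surj W p →
      ∃ (M : ℕ) (_ : NeZero M) (g : CuspForm (Gamma0 M) 2) (ι : coeffField g →+* PadicAlgCl p) (Ω : ℂ),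
        ¬ p ∣ M ∧ IsNewform0 g ∧ Literature.NumberTheory.Automorphic.IsCMForm (liftToGamma1 M 2 g) ∧
          cuspCoeff g p = 0 ∧ IsCohomologicalPlusPeriod g ι Ω ∧
          (∀ ℓ : ℕ, ℓ.Prime → ¬ ℓ ∣ p * M * W.conductorNorm ℤ →
            ‖embCoeff g ι ℓ - (W.frobeniusTrace ℓ : PadicAlgCl p)‖ < 1) :=
  heckeThetaPartner_sansLevel_classwide

end Summit.BirchSwinnertonDyer.BirchSwinnertonDyer.Theorems.SmallImageLambdaLowerThreeNsThetaPartner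

end
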